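import Summits.ResolutionOfSingularities.ResolutionOfSingularities.Theorems.EquisingularLiftEquisingularLiftNatLinearCentre
import HarnessLib

/-!
# [OURS · L1 W4.5(b)] EL♮ helper — T-LIFT: EMBEDDED `O`-LIFTS of a closed subscheme `Σ ⊆ ℙ^N_k` to `ℙ^N_O`

Cell res-hironaka, LADDER-RESOLUTION rung L (D-0089), slot W4.5(b), crux `Theses.EquisingularLift.EquisingularLiftNat`
(stmt-ResolutionOfSingularities-20038) and its `n = 3` child `EquisingularLiftNatThree` (stmt-ResolutionOfSingularities-20148);
object **T-LIFT typing** of res-L1-w45b-lead-2's target list (LEAD-MEMO-1 §5, CHAIN w45b v7.3 §3 «T-LIFT typing … LIFT(Σ) and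
H¹(N_Σ) = 0 ⇒ LIFT»), `--supports stmt-ResolutionOfSingularities-20148 --as helper`. NOT a statement of any manuscript; OURS
vocabulary for LEVEL 0 of `stub_elnat_three_nonisolated` («the first centre touching η_Σ is a NOSE ⟺ Σ lifts as an embedded
curve», CRUX-PLAN §1.3 / LEAD-MEMO-1 §3; pushdown kernel p500010/p501971/p502697/p503206). AI-written; AI review is weaker
than expert review.

SETTING (the EL♮ item's spelling, as in `…NatLinearCentre.lean`). `O` a commutative ring (local / a DVR where needed),
`π : O → k` a surjection onto a field `k`, `φ : O[x] →ᵍ k[x]` the graded coefficient map (`φ s = MvPolynomial.map π s`) with the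
`Proj.map` hypothesis `hφ'`, `g := Proj.map φ hφ' : ℙ^N_k → ℙ^N_O = P` (the special-fibre inclusion),
`q := Proj.toSpecZero _ ≫ Spec.map (algebraMap O (O[x])₀) : P → Spec O`, `s₀ := IsLocalRing.closedPoint O`;
`ι : S ⟶ ℙ^N_k` a closed immersion of a scheme `S` (the memos' `Σ`; `Σ` is a reserved token in Lean) (in the crux: the reduced singular curve `Σ ⊆ Sing H`, or `H` itself).

CONTENT.
* `LiftsEmbedded φ hφ' ι D` — the ideal sheaf `D` on `P` is an **embedded `O`-lift of `Σ`**: `V(D) → Spec O` is flat and the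
  scheme-theoretic special fibre of `V(D)` is `Σ`, i.e. `D|_{ℙ^N_k} := D.comap g = ι.ker` (Mathlib `IdealSheafData.comap` = the
  ideal sheaf of `V(D) ×_P ℙ^N_k ⊆ ℙ^N_k`). This is the conclusion of Hartshorne, *Deformation Theory* Thm. 22.3 in the chain's
  currency (the named fact `Literature.AlgebraicGeometry.Deformation.Hartshorne2010_thm_22_3` is typed separately; its one-line
  consumption `exists_liftsEmbedded_of_normalH1` is appended once that file is in the tree).
* API in the currency of the HorizChainE1 step clauses (p500485 / p502282): `LiftsEmbedded.flat`, `.comap_eq`,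
  `.preimage_support` (`g⁻¹ supp D = range ι`), `.support_inter_specialFibre` (`supp D ∩ q⁻¹{s₀} = range (ι ≫ g)`, `O` local),
  `.support_inter_specialFibre_subset_range` (the E1-shaped clause when `Σ ⊆ H`), `.le_ker_comp` / `.lift` / `.lift_fac` /
  `.isPullback` (`Σ = V(D) ×_P ℙ^N_k` as a pullback square, Mathlib `isPullback_of_isClosedImmersion`).

References: [Hartshorne2010, §22 Thm. 22.3 p. 169] (the shape of «lift as a subscheme of ℙ^r, flat over R, with X ×_R k = X₀»);
tree `…NatLinearCentre.lean` (`LinearCentre.range_projMap_eq_specialFibre`) — OURS, index only.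
-/

set_option linter.dupNamespace false -- mandated namespace `Summit.<Summit>.<Problem>` of this single-conjunct summit

noncomputable section

open CategoryTheory CategoryTheory.Limits AlgebraicGeometry TopologicalSpace
open MvPolynomial
open AlgebraicGeometry.Scheme.IdealSheafData

attribute [local instance] MvPolynomial.gradedAlgebra

namespace Summit.ResolutionOfSingularities.ResolutionOfSingularities.Cruxes.EquisingularLiftNat

namespace EmbeddedLift

section Def

variable {O k : Type} [CommRing O] [CommRing k] {N : ℕ}
  (φ : (homogeneousSubmodule (Fin (N + 1)) O) →+*ᵍ (homogeneousSubmodule (Fin (N + 1)) k))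
  (hφ' : HomogeneousIdeal.irrelevant (homogeneousSubmodule (Fin (N + 1)) k) ≤
    (HomogeneousIdeal.irrelevant (homogeneousSubmodule (Fin (N + 1)) O)).map φ)
  {S : Scheme.{0}} (ι : S ⟶ Proj (homogeneousSubmodule (Fin (N + 1)) k))
  (D : (Proj (homogeneousSubmodule (Fin (N + 1)) O)).IdealSheafData)

/-- **[OURS · L1 W4.5(b) · T-LIFT]** **`D` is an embedded `O`-lift of `S ↪ ℙ^N_k`** (`S` = the memo's `Σ`): the closed subscheme `V(D) ⊆ P = ℙ^N_O` is
FLAT over `Spec O` (via `q = Proj.toSpecZero ≫ Spec (O → O[x]₀)`) and its scheme-theoretic special fibre is `Σ`: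
the pulled-back ideal sheaf `D.comap (Proj.map φ hφ')` on `ℙ^N_k` (ideal of `V(D) ×_P ℙ^N_k`) equals `ι.ker`. The conclusion of
[Hartshorne2010, Thm. 22.3] «a closed subscheme X of ℙ^r_R, flat over R, with X ×_R k = X₀» in the EL♮ chain's spelling.
NOT a statement of the manuscript under adjudication. -/
def LiftsEmbedded : Prop :=
  Flat (D.subschemeι ≫ Proj.toSpecZero (homogeneousSubmodule (Fin (N + 1)) O) ≫
      Spec.map (CommRingCat.ofHom (algebraMap O ((homogeneousSubmodule (Fin (N + 1)) O) 0)))) ∧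
    D.comap (Proj.map φ hφ') = ι.ker

variable {φ hφ' ι D}

/-- An embedded lift is flat over `O`. [folklore] -/
theorem LiftsEmbedded.flat (h : LiftsEmbedded φ hφ' ι D) :
    Flat (D.subschemeι ≫ Proj.toSpecZero (homogeneousSubmodule (Fin (N + 1)) O) ≫
      Spec.map (CommRingCat.ofHom (algebraMap O ((homogeneousSubmodule (Fin (N + 1)) O) 0)))) :=
  h.1

/-- The special fibre of an embedded lift of `Σ` is `Σ` (ideal sheaves on `ℙ^N_k`). [folklore] -/
theorem LiftsEmbedded.comap_eq (h : LiftsEmbedded φ hφ' ι D) : D.comap (Proj.map φ hφ') = ι.ker :=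
  h.2

/-- Set-theoretic special fibre of an embedded lift: `g⁻¹(supp D) = range ι` for `g = Proj φ : ℙ^N_k → ℙ^N_O` (`ι` a closed
immersion). [folklore] -/
theorem LiftsEmbedded.preimage_support [IsClosedImmersion ι] (h : LiftsEmbedded φ hφ' ι D) :
    (Proj.map φ hφ') ⁻¹' (D.support : Set (Proj (homogeneousSubmodule (Fin (N + 1)) O))) = Set.range ι := by
  have h1 : ((D.comap (Proj.map φ hφ')).support : Set (Proj (homogeneousSubmodule (Fin (N + 1)) k))) =
      (Proj.map φ hφ') ⁻¹' (D.support : Set (Proj (homogeneousSubmodule (Fin (N + 1)) O))) := by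
    rw [support_comap]; rfl
  rw [← h1, h.comap_eq, Scheme.Hom.support_ker, ι.isClosedEmbedding.isClosed_range.closure_eq]

/-- `D ≤ ker (ι ≫ g)`: the composite `Σ → ℙ^N_k → ℙ^N_O` kills the ideal sheaf of the lift. [folklore] -/
theorem LiftsEmbedded.le_ker_comp (h : LiftsEmbedded φ hφ' ι D) : D ≤ (ι ≫ Proj.map φ hφ').ker := by
  rw [← map_ker, ← h.comap_eq]
  exact le_map_comap _ _

/-- The factorisation `Σ → V(D)` of `ι ≫ g` through the closed subscheme of the lift (Mathlib `IsClosedImmersion.lift`).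
[folklore] -/
def LiftsEmbedded.lift (h : LiftsEmbedded φ hφ' ι D) : S ⟶ D.subscheme :=
  IsClosedImmersion.lift D.subschemeι (ι ≫ Proj.map φ hφ') (by rw [ker_subschemeι]; exact h.le_ker_comp)

/-- `Σ → V(D) ↪ ℙ^N_O` is `ι ≫ g`. [folklore] -/
theorem LiftsEmbedded.lift_fac (h : LiftsEmbedded φ hφ' ι D) : h.lift ≫ D.subschemeι = ι ≫ Proj.map φ hφ' :=
  IsClosedImmersion.lift_fac _ _ _

/-- **`Σ = V(D) ×_{ℙ^N_O} ℙ^N_k`**: for an embedded lift, the square `Σ → V(D)`, `ι`, `g`, `V(D) ↪ ℙ^N_O` is a pullback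
(`ι` a closed immersion). [folklore] -/
theorem LiftsEmbedded.isPullback [IsClosedImmersion ι] (h : LiftsEmbedded φ hφ' ι D) :
    IsPullback ι h.lift (Proj.map φ hφ') D.subschemeι :=
  isPullback_of_isClosedImmersion ι D.subschemeι h.lift (Proj.map φ hφ') h.lift_fac.symm
    (by rw [ker_subschemeι, h.comap_eq])

end Def

section Surj

variable {O k : Type} [CommRing O] [CommRing k] (π : O →+* k) (hπ : Function.Surjective π) {N : ℕ}
  {φ : (homogeneousSubmodule (Fin (N + 1)) O) →+*ᵍ (homogeneousSubmodule (Fin (N + 1)) k)}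
  (hφ : ∀ q, φ q = MvPolynomial.map π q)
  {hφ' : HomogeneousIdeal.irrelevant (homogeneousSubmodule (Fin (N + 1)) k) ≤
    (HomogeneousIdeal.irrelevant (homogeneousSubmodule (Fin (N + 1)) O)).map φ}
  {S : Scheme.{0}} {ι : S ⟶ Proj (homogeneousSubmodule (Fin (N + 1)) k)}
  {D : (Proj (homogeneousSubmodule (Fin (N + 1)) O)).IdealSheafData}

include hπ hφ in
/-- `Σ → V(D)` is a closed immersion (`π` surjective): `ι ≫ g` is one — `g = Proj φ` is a closed immersion for surjective `φ`
(tree `FundamentalGroup.isClosedImmersion_projMap_of_surjective`, Hartshorne II Ex. 3.12 (a)) — and `ι ≫ g = lift ≫ (V(D) ↪ P)`.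
[folklore] -/
theorem LiftsEmbedded.isClosedImmersion_lift [IsClosedImmersion ι] (h : LiftsEmbedded φ hφ' ι D) :
    IsClosedImmersion h.lift := by
  haveI : IsClosedImmersion (Proj.map φ hφ') :=
    Literature.AlgebraicGeometry.FundamentalGroup.isClosedImmersion_projMap_of_surjective φ hφ' fun q => by
      obtain ⟨s, hs⟩ := MvPolynomial.map_surjective π hπ q
      exact ⟨s, (hφ s).trans hs⟩
  exact @IsClosedImmersion.of_comp_isClosedImmersion _ _ _ h.lift D.subschemeι inferInstance
    (by rw [h.lift_fac]; infer_instance)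

end Surj

section SpecialFibre

variable {O k : Type} [CommRing O] [IsLocalRing O] [Field k] (π : O →+* k) (hπ : Function.Surjective π) {N : ℕ}
  {φ : (homogeneousSubmodule (Fin (N + 1)) O) →+*ᵍ (homogeneousSubmodule (Fin (N + 1)) k)}
  (hφ : ∀ q, φ q = MvPolynomial.map π q)
  {hφ' : HomogeneousIdeal.irrelevant (homogeneousSubmodule (Fin (N + 1)) k) ≤
    (HomogeneousIdeal.irrelevant (homogeneousSubmodule (Fin (N + 1)) O)).map φ}
  {S : Scheme.{0}} {ι : S ⟶ Proj (homogeneousSubmodule (Fin (N + 1)) k)}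
  {D : (Proj (homogeneousSubmodule (Fin (N + 1)) O)).IdealSheafData}

include hπ hφ in
/-- **The special support of an embedded lift is `Σ`**: `supp D ∩ q⁻¹{s₀} = range (ι ≫ g)` (`O` local, `k` a field, `π`
surjective; `range g = q⁻¹{s₀}` is `LinearCentre.range_projMap_eq_specialFibre`). [folklore] -/
theorem LiftsEmbedded.support_inter_specialFibre [IsClosedImmersion ι] (h : LiftsEmbedded φ hφ' ι D) :
    (D.support : Set (Proj (homogeneousSubmodule (Fin (N + 1)) O))) ∩
        (Proj.toSpecZero (homogeneousSubmodule (Fin (N + 1)) O) ≫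
            Spec.map (CommRingCat.ofHom (algebraMap O ((homogeneousSubmodule (Fin (N + 1)) O) 0)))) ⁻¹'
          {IsLocalRing.closedPoint O} =
      Set.range (ι ≫ Proj.map φ hφ') := by
  rw [← LinearCentre.range_projMap_eq_specialFibre π hπ φ hφ hφ', ← Set.image_preimage_eq_inter_range,
    h.preimage_support, ← Set.range_comp]
  ext x
  simp only [Set.mem_range, Function.comp_apply, Scheme.Hom.comp_apply]

include hπ hφ in
/-- **E1-shaped clause at level 0 for an embedded lift**: if `Σ ⊆ H` (`range ι ⊆ range ι_H`), the special-fibre points of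
`supp D` lie in `Y = range (ι_H ≫ g)` — the clause `(C.support) ∩ (𝟙 ≫ q)⁻¹{s₀} ⊆ Y` of a HorizChainE1 step from
`(ℙ^N_O, 𝟙, Y)` (cf. `LinearCentre.support_inter_specialFibre_subset_range`). [folklore] -/
theorem LiftsEmbedded.support_inter_specialFibre_subset_range [IsClosedImmersion ι] (h : LiftsEmbedded φ hφ' ι D)
    {H : Scheme.{0}} (ιH : H ⟶ Proj (homogeneousSubmodule (Fin (N + 1)) k)) (hSH : Set.range ι ⊆ Set.range ιH) :
    (D.support : Set (Proj (homogeneousSubmodule (Fin (N + 1)) O))) ∩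
        (𝟙 (Proj (homogeneousSubmodule (Fin (N + 1)) O)) ≫
          (Proj.toSpecZero (homogeneousSubmodule (Fin (N + 1)) O) ≫
            Spec.map (CommRingCat.ofHom (algebraMap O ((homogeneousSubmodule (Fin (N + 1)) O) 0))))) ⁻¹'
          {IsLocalRing.closedPoint O} ⊆
      Set.range (ιH ≫ Proj.map φ hφ') := by
  rw [Category.id_comp, h.support_inter_specialFibre π hπ hφ]
  rintro _ ⟨y, rfl⟩
  obtain ⟨x, hx⟩ := hSH ⟨y, rfl⟩
  exact ⟨x, by rw [Scheme.Hom.comp_apply, Scheme.Hom.comp_apply, hx]⟩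

end SpecialFibre

end EmbeddedLift

end Summit.ResolutionOfSingularities.ResolutionOfSingularities.Cruxes.EquisingularLiftNat

end
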